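import Summits.AtomisticToContinuum.Crystallization.Theorems.OverbindingBudgetAffineBarlowSum

/-!
# OverbindingBudget — the far hcp INHABITANT of the `FarCoreExcess` hypothesis class (probe P5)
# (decomp-a2c lens-4 «minimal-counterexample / extremal reduction», generation 46/48; S support under slot Z of `stmt-AtomisticToContinuum-31280`)

Imports ONLY `…Theorems.OverbindingBudgetAffineBarlowSum` (for `chartAdmissible_of_first_shell`, `barlowTriple`).  PROVED, 0 sorry.  Purpose: the universal
quantifier of Z2 `FarCoreExcess (1/25) (1/2000) κ` ("every admissible, `θ₀`-pattern-far chart has reference energy `≥ e* + κ + m`") ranges over a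
NONEMPTY class — the critic's probe P5 (row 743) asked for an explicit inhabitant.  Here it is, over the Literature's Hägg-coded hcp structure
`barlowStacking 1 √(2/3) alternatingHagg` (no new stacking vocabulary):

* `stretchZ t` — the uniaxial stretch `diag(1,1,t)` along the layer normal (+ `norm_le_norm_stretchZ`, `norm_stretchZ_sub_le`);
* the LAYER FRAME is the Literature's `closePackingFrameLin 1` (`LayerShellPatterns.lean`: rows `−(1,−1,0)/√2, −(1,1,−2)/√6, (1,1,1)/√3`; isometry
  `closePackingFrame 1`, `norm_closePackingFrameLin`) — not re-defined here (review 2026-09-01); `hcpIdx` + ★ `closePackingFrameLin_one_pattern` — the 18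
  scale-`1` identities `closePackingFrameLin 1 (z/√18) = barlowTriple alternatingHagg (hcpIdx z)` placing the tree's integer-model pattern points at explicit
  Barlow indices `(L, i, j)` (first shell: six in-plane, three in each layer `±1`; second shell: three in each layer `±1`; the Literature's
  `two_smul_closePackingFrame_smul_intVec` is the scale-`2` frame form);
* `farHcpChart := ⟨alternatingHagg, stretchZ (501/500), 1, 1⟩`; ★ `chartAdmissible_farHcpChart : ChartAdmissible (1/25) farHcpChart` (stretch `1/500 ≤ 3θ`,
  first-shell minimum of `‖B ·‖` attained in-plane because a stretch with `t ≥ 1` does not decrease norms, summability from BarlowSum′);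
  ★ `patternFar_farHcpChart : 0 ≤ τ → PatternFar (1/2000) τ farHcpChart` (frame `A₀ = B ∘ closePackingFrameLin 1` matched EXACTLY by
  `π = closePackingFrameLin 1`, far because the
  layer-`1` contact direction is stretched to length `√(752002/750000) > 1 + 1/2000`, which no isometry matches);
* ★ `exists_chartAdmissible_patternFar : ∃ c, ChartAdmissible (1/25) c ∧ ∀ τ ≥ 0, PatternFar (1/2000) τ c`.

Numerically (census-1 g23 by-product row, informational): an inhabitant of this type with the energy-optimal far strain has reference-energy excess
`≈ 8.3·10⁻⁷ ≫ κ + m`; the BINDING charts of Z2 are the fcc-centre windows with aligned second layers (`c_Z = 0.367`, excess `9.17·10⁻⁸ = 1.83 κ`).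
-/

namespace Summit.AtomisticToContinuum.Crystallization.Theorems.OverbindingBudgetAffineFarSmoothSplit

open scoped BigOperators Classical
open Literature.MathematicalPhysics.StatisticalMechanics
open Literature.Geometry.DiscreteGeometry (hcpTwoShellPattern intVec intVec_apply scaledPattern hcpInt hcpSecondShellInt hcpKissingPattern
  norm_of_mem_hcpTwoShellPattern norm_eq_one_of_mem_hcpKissingPattern closePackingFrameLin closePackingFrameLin_apply_zero closePackingFrameLin_apply_one
  closePackingFrameLin_apply_two norm_closePackingFrameLin layerSpacing norm_sq_fin3 sqrt_eighteen_eq)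

local notation "E3" => EuclideanSpace ℝ (Fin 3)

/-! ## The far hcp inhabitant (probe P5 of the `FarCoreExcess` battery): a z-stretched hcp chart is admissible and `θ₀`-pattern-far -/

section Inhabitant

/-- The uniaxial stretch `diag(1, 1, t)` along the layer normal. -/
noncomputable def stretchZ (t : ℝ) : E3 →ₗ[ℝ] E3 where
  toFun v := WithLp.toLp 2 ![v 0, v 1, t * v 2]
  map_add' v w := by ext k; fin_cases k <;> simp [mul_add]
  map_smul' r v := by ext k; fin_cases k <;> simp [mul_left_comm r t]

/-- `stretchZ t` fixes the first coordinate. [formal bookkeeping] -/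
@[simp] theorem stretchZ_apply_zero (t : ℝ) (v : E3) : stretchZ t v 0 = v 0 := rfl
/-- `stretchZ t` fixes the second coordinate. [formal bookkeeping] -/
@[simp] theorem stretchZ_apply_one (t : ℝ) (v : E3) : stretchZ t v 1 = v 1 := rfl
/-- `stretchZ t` scales the third coordinate by `t`. [formal bookkeeping] -/
@[simp] theorem stretchZ_apply_two (t : ℝ) (v : E3) : stretchZ t v 2 = t * v 2 := rfl

/-- A stretch with `t ≥ 1` does not decrease norms. [this file] -/
theorem norm_le_norm_stretchZ {t : ℝ} (ht : 1 ≤ t) (v : E3) : ‖v‖ ≤ ‖stretchZ t v‖ := by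
  have h1 := norm_sq_fin3 v
  have h2 := norm_sq_fin3 (stretchZ t v)
  simp only [stretchZ_apply_zero, stretchZ_apply_one, stretchZ_apply_two] at h2
  have : ‖v‖ ^ 2 ≤ ‖stretchZ t v‖ ^ 2 := by
    rw [h1, h2, mul_pow]; nlinarith [sq_nonneg (v 2), one_le_pow₀ (M₀ := ℝ) (n := 2) ht]
  exact (pow_le_pow_iff_left₀ (norm_nonneg _) (norm_nonneg _) two_ne_zero).1 this

/-- `‖stretchZ t v − v‖ ≤ |t − 1| ‖v‖`. [this file] -/
theorem norm_stretchZ_sub_le (t : ℝ) (v : E3) : ‖stretchZ t v - v‖ ≤ |t - 1| * ‖v‖ := by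
  have h := norm_sq_fin3 (stretchZ t v - v)
  simp only [PiLp.sub_apply, stretchZ_apply_zero, stretchZ_apply_one, stretchZ_apply_two, sub_self] at h
  have hv : (v 2) ^ 2 ≤ ‖v‖ ^ 2 := by rw [norm_sq_fin3]; nlinarith [sq_nonneg (v 0), sq_nonneg (v 1)]
  have : ‖stretchZ t v - v‖ ^ 2 ≤ (|t - 1| * ‖v‖) ^ 2 := by
    rw [h, mul_pow, sq_abs]; nlinarith [sq_nonneg (t - 1)]
  exact (pow_le_pow_iff_left₀ (norm_nonneg _) (by positivity) two_ne_zero).1 this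

/-- The index table of the layer frame: the integer vector `z` of the tree's hcp pattern (scale `√18`) sits at Barlow index `(L, i, j)` of
`barlowStacking 1 √(2/3) alternatingHagg`, with `L = (z₀+z₁+z₂)/6`, label `ℓ = L mod 2`, `j = (−z₀−z₁+2z₂−3ℓ)/9`, `i = (z₁−z₀−3j−3ℓ)/6` — built from `ℤ`
`/` and `%`, hence MEANINGFUL ONLY ON `hcpInt ∪ hcpSecondShellInt`, where `closePackingFrameLin_one_pattern` verifies it; arbitrary values elsewhere. -/
def hcpIdx (z : Fin 3 → ℤ) : ℤ × ℤ × ℤ :=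
  ((z 0 + z 1 + z 2) / 6,
    ((z 1 - z 0) - 3 * (((-z 0 - z 1 + 2 * z 2) - 3 * ((z 0 + z 1 + z 2) / 6 % 2)) / 9) - 3 * ((z 0 + z 1 + z 2) / 6 % 2)) / 6,
    ((-z 0 - z 1 + 2 * z 2) - 3 * ((z 0 + z 1 + z 2) / 6 % 2)) / 9)

/-- **The Literature layer frame `closePackingFrameLin 1` maps the tree's hcp two-shell pattern INTO the Hägg-coded hcp structure**, point by point
(18 scale-`1` identities). [this file] -/
theorem closePackingFrameLin_one_pattern : ∀ z ∈ hcpInt ∪ hcpSecondShellInt,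
    closePackingFrameLin 1 ((Real.sqrt 18)⁻¹ • intVec z) = barlowTriple alternatingHagg (hcpIdx z) := by
  intro z hz
  have h2 : Real.sqrt 2 ≠ 0 := by positivity
  simp only [hcpInt, hcpSecondShellInt, Finset.mem_union, Finset.mem_insert, Finset.mem_singleton] at hz
  rcases hz with (rfl | rfl | rfl | rfl | rfl | rfl | rfl | rfl | rfl | rfl | rfl | rfl) | (rfl | rfl | rfl | rfl | rfl | rfl)
  all_goals
    ext k; fin_cases k <;>
      simp [barlowTriple, hcpIdx, barlowPos_apply_zero, barlowPos_apply_one, barlowPos_apply_two, haggLabel_alternating,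
        sqrt_eighteen_eq, intVec, layerSpacing] <;>
      field_simp <;> ring

/-- The P5 INHABITANT: the hcp structure (`alternatingHagg`) read through the uniaxial stretch `diag(1, 1, 501/500)`, unit scale, `nn = 1`. -/
noncomputable def farHcpChart : Chart := ⟨alternatingHagg, stretchZ (501 / 500), 1, 1⟩

/-- The in-plane first-shell point `barlowPos … 0 1 0 = (1, 0, 0)`: coordinates. [this file] -/
theorem barlowPos_zero_one_zero_apply :
    barlowPos 1 (Real.sqrt (2 / 3)) alternatingHagg 0 1 0 0 = 1 ∧ barlowPos 1 (Real.sqrt (2 / 3)) alternatingHagg 0 1 0 1 = 0 ∧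
      barlowPos 1 (Real.sqrt (2 / 3)) alternatingHagg 0 1 0 2 = 0 := by
  simp [barlowPos_apply_zero, barlowPos_apply_one, barlowPos_apply_two]

/-- `‖barlowPos … 0 1 0‖ = 1` and it is fixed by the stretch, so `‖B w₁‖ = 1`. [this file] -/
theorem norm_stretchZ_w₁ (t : ℝ) : ‖stretchZ t (barlowPos 1 (Real.sqrt (2 / 3)) alternatingHagg 0 1 0)‖ = 1 ∧
    ‖barlowPos 1 (Real.sqrt (2 / 3)) alternatingHagg 0 1 0‖ = 1 := by
  obtain ⟨h0, h1, h2⟩ := barlowPos_zero_one_zero_apply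
  have ha := norm_sq_fin3 (stretchZ t (barlowPos 1 (Real.sqrt (2 / 3)) alternatingHagg 0 1 0))
  have hb := norm_sq_fin3 (barlowPos 1 (Real.sqrt (2 / 3)) alternatingHagg 0 1 0)
  simp only [stretchZ_apply_zero, stretchZ_apply_one, stretchZ_apply_two, h0, h1, h2] at ha hb
  have ha' : ‖stretchZ t (barlowPos 1 (Real.sqrt (2 / 3)) alternatingHagg 0 1 0)‖ ^ 2 = 1 := by rw [ha]; ring
  have hb' : ‖barlowPos 1 (Real.sqrt (2 / 3)) alternatingHagg 0 1 0‖ ^ 2 = 1 := by rw [hb]; ring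
  exact ⟨(pow_eq_one_iff_of_nonneg (norm_nonneg _) two_ne_zero).1 ha', (pow_eq_one_iff_of_nonneg (norm_nonneg _) two_ne_zero).1 hb'⟩

/-- **The inhabitant is admissible at the record distortion `θ = 1/25`** (stretch `1/500 ≤ 3θ`; the first-shell minimum of `‖B ·‖` is attained in-plane,
since a stretch with `t ≥ 1` does not decrease norms; summability from BarlowSum′). [this file] -/
theorem chartAdmissible_farHcpChart : ChartAdmissible (1 / 25) farHcpChart := by
  have hB : ∃ Q : E3 →ₗᵢ[ℝ] E3, ∀ v, ‖stretchZ (501 / 500) v - Q v‖ ≤ 1 / 500 * ‖v‖ :=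
    ⟨LinearIsometry.id, fun v => by
      have h := norm_stretchZ_sub_le (501 / 500) v
      norm_num at h
      simpa using h⟩
  obtain ⟨hB₁, h₁⟩ := norm_stretchZ_w₁ (501 / 500)
  have h := chartAdmissible_of_first_shell (θ := 1 / 25) (m := 1 / 500) (by norm_num) (by norm_num) isHaggSeq_alternating hB one_pos
    (barlowPos_mem 0 1 0) h₁ (fun p _ hp1 => by rw [hB₁, ← hp1]; exact norm_le_norm_stretchZ (by norm_num) p)
  rw [hB₁, mul_one] at h
  exact h

/-- **The inhabitant is `θ₀ = 1/2000`-pattern-far at every tolerance `τ ≥ 0`**: frame `A₀ = B ∘ closePackingFrameLin 1` on the tree's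
`hcpTwoShellPattern`, matched EXACTLY by `π = closePackingFrameLin 1` (which lands in `twoShellRef alternatingHagg` by `closePackingFrameLin_one_pattern`);
far because the layer-`1` contact direction is stretched
to length `√(752002/750000) > 1 + 1/2000`, which no isometry matches. [this file] -/
theorem patternFar_farHcpChart {τ : ℝ} (hτ : 0 ≤ τ) : PatternFar (1 / 2000) τ farHcpChart := by
  refine ⟨(farHcpChart.a₀ / farHcpChart.nn) • (stretchZ (501 / 500) ∘ₗ closePackingFrameLin 1), hcpTwoShellPattern, closePackingFrameLin 1,
    Or.inr rfl, ?_, ?_, ?_⟩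
  · intro v hv
    have hv' := hv
    simp only [hcpTwoShellPattern, scaledPattern, Finset.mem_image] at hv'
    obtain ⟨z, hz, rfl⟩ := hv'
    have hn := norm_closePackingFrameLin (σ := 1) (Or.inl rfl) ((Real.sqrt (18 : ℕ))⁻¹ • intVec z)
    refine ⟨⟨?_, ?_, ?_⟩, ?_⟩
    · rw [show ((18 : ℕ) : ℝ) = 18 by norm_num, closePackingFrameLin_one_pattern z hz]
      exact barlowPos_mem _ _ _
    · intro h0
      rw [h0, norm_zero] at hn
      rcases norm_of_mem_hcpTwoShellPattern hv with h1 | h1 <;> rw [h1] at hn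
      · exact zero_ne_one hn
      · have : (0 : ℝ) < Real.sqrt 2 := by positivity
        linarith
    · rw [hn]
      rcases norm_of_mem_hcpTwoShellPattern hv with h1 | h1 <;> rw [h1]
      · norm_num
      · exact (Real.sqrt_le_sqrt (by norm_num : (2 : ℝ) ≤ (3 / 2) ^ 2)).trans_eq (Real.sqrt_sq (by norm_num))
    · simp [farHcpChart, hτ]
  · intro v _ w _ h   -- `closePackingFrameLin 1` is an isometry (`closePackingFrame 1`), hence injective
    have hn := norm_closePackingFrameLin (σ := 1) (Or.inl rfl) (v - w)
    rw [map_sub, h, sub_self, norm_zero] at hn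
    exact sub_eq_zero.1 (norm_eq_zero.1 hn.symm)
  · intro Q
    have hmem : ![(0 : ℤ), 3, 3] ∈ hcpInt ∪ hcpSecondShellInt := by decide
    refine ⟨(Real.sqrt (18 : ℕ))⁻¹ • intVec ![0, 3, 3], ?_, ?_⟩
    · simp only [hcpTwoShellPattern, scaledPattern, Finset.mem_image]
      exact ⟨_, hmem, rfl⟩
    · have hv1 : ‖(Real.sqrt (18 : ℕ))⁻¹ • intVec ![(0 : ℤ), 3, 3]‖ = 1 :=
        norm_eq_one_of_mem_hcpKissingPattern (by
          simp only [hcpKissingPattern, scaledPattern, Finset.mem_image]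
          exact ⟨_, by decide, rfl⟩)
      have hid := closePackingFrameLin_one_pattern _ hmem
      have hidx : hcpIdx ![(0 : ℤ), 3, 3] = (1, 0, 0) := by decide
      rw [show ((18 : ℕ) : ℝ) = 18 by norm_num] at hv1 ⊢
      -- the stretched image of the layer-1 contact direction
      have hA : ((farHcpChart.a₀ / farHcpChart.nn) • (stretchZ (501 / 500) ∘ₗ closePackingFrameLin 1)) ((Real.sqrt 18)⁻¹ • intVec ![(0 : ℤ), 3, 3]) =
          stretchZ (501 / 500) (barlowPos 1 (Real.sqrt (2 / 3)) alternatingHagg 1 0 0) := by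
        simp only [LinearMap.smul_apply, LinearMap.comp_apply, hid, hidx, barlowTriple, farHcpChart]
        simp
      have h3 : Real.sqrt 3 ^ 2 = 3 := Real.sq_sqrt (by norm_num)
      have h23 : Real.sqrt (2 / 3) ^ 2 = 2 / 3 := Real.sq_sqrt (by norm_num)
      have hsq : ‖stretchZ (501 / 500) (barlowPos 1 (Real.sqrt (2 / 3)) alternatingHagg 1 0 0)‖ ^ 2 = 752002 / 750000 := by
        rw [norm_sq_fin3]
        simp only [stretchZ_apply_zero, stretchZ_apply_one, stretchZ_apply_two, barlowPos_apply_zero, barlowPos_apply_one,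
          barlowPos_apply_two, haggLabel_alternating, Int.not_even_one, if_false, Int.cast_zero, Int.cast_one]
        linear_combination (1 / 36) * h3 + (251001 / 250000) * h23
      have hgt : 2001 / 2000 < ‖stretchZ (501 / 500) (barlowPos 1 (Real.sqrt (2 / 3)) alternatingHagg 1 0 0)‖ := by
        by_contra hle
        have hle' := not_lt.1 hle
        nlinarith [norm_nonneg (stretchZ (501 / 500) (barlowPos 1 (Real.sqrt (2 / 3)) alternatingHagg 1 0 0))]
      rw [hA]
      have htri := norm_sub_norm_le (stretchZ (501 / 500) (barlowPos 1 (Real.sqrt (2 / 3)) alternatingHagg 1 0 0))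
        (Q ((Real.sqrt 18)⁻¹ • intVec ![(0 : ℤ), 3, 3]))
      rw [Q.norm_map, hv1] at htri
      linarith

/-- ★ **P5: the hypothesis class of `FarCoreExcess (1/25) (1/2000) κ` is INHABITED** — an admissible chart that is `θ₀`-pattern-far at every tolerance
(so Z2's universal quantifier is not vacuous; the far excess of this inhabitant is `≈ 8·10⁻⁷ ≫ κ`, census-1 g23). [this file] -/
theorem exists_chartAdmissible_patternFar :
    ∃ c : Chart, ChartAdmissible (1 / 25) c ∧ ∀ τ : ℝ, 0 ≤ τ → PatternFar (1 / 2000) τ c :=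
  ⟨farHcpChart, chartAdmissible_farHcpChart, fun _ hτ => patternFar_farHcpChart hτ⟩

end Inhabitant

end Summit.AtomisticToContinuum.Crystallization.Theorems.OverbindingBudgetAffineFarSmoothSplit
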